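/-
COR-CM (cell pub-hodgecm2, stage 2 of the Hodge ladder) — TRANSPOSITION SURGE, item (vi) of rfwf v3 §4.2, sub-binder
(vi-3) WEDGE, `TranslateClosed` half (hodge-director/ITEM6-SPLIT.md §(c′) row (vi-3); theta-3 pointer
hodge-director/INBOX l.427 item (4)).  AUTHORED by seat prover-pub-hodgecm2-item6-p4-0 (unit pub-hodgecm2-item6-p4);
sequel of `Transposition/Item6HeckeFamily.lean` (p277416) over the Literature junction
`UnitaryBallClassLiftHeckePullback` (p279757).  One `def` (a Sylvester frame of the ball datum of a level read off a
Sylvester matrix of `V` at `ι₁`) + one `def … : Prop` (the level-specific EXISTENCE shape of the theta/ball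
dictionary) + theorems; nothing cited as a record; nothing asserted; FRAMING (COORDINATOR RULING 2026-08-21T11:55:35Z):
HC_CM is NOT proved.
-/
import Summits.HodgeConjecture.CorCM.B01.Transposition.Item6HeckeFamily
import Summits.HodgeConjecture.CorCM.B01.PeriodExpansion
import Summits.HodgeConjecture.CorCM.Model.PerLConeFacts
import Literature.AlgebraicGeometry.ShimuraVarieties.UnitaryBallClassLiftHeckePullback
import HarnessLib

/-!
# Transposition item (vi-3): `TranslateClosed` along the honest Hecke family from the EXISTENCE shape of the dictionary

`FaceThetaSupply.TranslateClosed S Hk` (`Transposition/Item6SupplyAssembly.lean` :165) asks, for every morphism `g` of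
the family and every theta class `η ∈ S.Theta i Γ`, that the PULLED-BACK CLASS `g^* η` be a theta class at the source
level.  The stage-1 package states Hecke stability of theta one-forms in the EXISTENCE shape of its ball facts
(`BallFacts.transl`: «`∃ ω' ∈ Θ_i(Γ')` whose lift to the ball is `γ^*(lift ω)`», PerL v5 §3.1 ll. 652–656
`γ^* u_f = u_{R(γ_f⁻¹) f}`), and the tree's automorphic glue delivers exactly that shape
(`UnitaryBallClassMapTranslate.exists_mem_thetaClasses_classLift_eq_of_rightTranslateHom`).  This file closes the gap on
the model universe `U = Model.picardCMUniverse hHD hI h₁ h₃` for the honest Hecke family `Transposition.Model.heckeFamily`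
(p277416):

* `Transposition.Model.frameOf V T hT Γ h` — the Sylvester frame of the ball datum of `U.pms L ι₁ V Γ` with matrix a
  given Sylvester matrix `T` of `V` at `ι₁` (`Tᴴ (V.Hm^{ι₁}) T = J`; all levels of the tower share the Gram matrix
  `V.Hm^{ι₁}`, `Model.ballDatum_Hℂ`), so that the frames of two levels have THE SAME MATRIX (`frameOf_t`);
* `Transposition.Model.LiftTranslate Θ T hT` — the level-specific EXISTENCE shape for a family of class sets
  `Θ Γ ⊆ H¹(U.pms L ι₁ V Γ; ℂ)`: for `γ ∈ U(V₃,h)(L)`, `Γ' ≤ Γ.heckePair γ` and `η ∈ Θ Γ` there is `η' ∈ Θ Γ'` whose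
  holomorphic lift in the frame `frameOf … Γ'` is `γ̂^*(lift η)`, `γ̂ = frameIso (frameOf … Γ) γ^{ι₁} ∈ U(2,1)`;
* `Transposition.Model.image_pullC_subset_of_liftTranslate` — for class sets inside `F¹H¹` with `LiftTranslate`, every
  `g ∈ (heckeFamily …).tr Γ Γ'` maps `Θ Γ` into `Θ Γ'` (`2 < [L:ℚ]`, so every code is anisotropic): the lift of `g^* η`
  IS `γ̂^*(lift η)` (`UnitaryBallClassLiftTranslate.classLift_pull_mulVec`, fed by `LiesOver.map_unif`) and the lift is
  injective on `F¹H¹` (`UnitaryBallClassLiftHeckePullback.pull_baseChange_mem_of_exists_classLift_eq_translate`);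
* `Transposition.Model.translateClosed_heckeFamily_of_liftTranslate` — for a supply datum `S` (its theta sets lie in
  `U_Ψ ⊆ H^{1,0} ⊆ F¹`, `Universe.Uiso_le_piece10`), `LiftTranslate (S.Theta i) T hT` for the four types gives
  `S.TranslateClosed (heckeFamily …)`; with `wedge_of_translateClosed_heckeFamily` (p277416):
  **`Transposition.Model.wedge_of_liftTranslate : S.Wedge`** — PerL Prop 4.3 on the model universe for ANY theta supply
  datum whose theta sets have the existence-shape Hecke-translate property, degree- and face-free.

What a non-saturated supplier then owes for Prop 4.3 is `LiftTranslate` for its theta-class sets, i.e. the adelic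
STABILITY `R(γ_f⁻¹) Θ(Γ) ⊆ Θ(Γ')` read through the class map (tree: `UnitaryBallClassMapTranslate`, PKG: theta-3's
`map_leftTranslateHom_thetaSpaceSatOf_le`).  HC_CM is NOT proved; nothing here inhabits `FaceThetaDataExists`.
-/

noncomputable section

open scoped TensorProduct Matrix
open NumberField CategoryTheory
open Literature.AlgebraicGeometry.Motives
open Literature.AlgebraicGeometry.ShimuraVarieties
open Literature.AlgebraicGeometry.HodgeTheory
open Literature.NumberTheory.Automorphic
open Literature.NumberTheory.Automorphic.PicardCM
open Literature.Geometry.ComplexHyperbolic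
open Literature.Geometry.ComplexHyperbolic.BallModel (U21 Ball Jac)

namespace Summit.HodgeConjecture.CorCM.Transposition.Model

open Summit.HodgeConjecture.CorCM.Model

variable {hHD : exists_isReal_hodgeModel} {hI : hodgePQ_independent_of_hodgeModel} {h₁ : BallQuotientUniformised}
  {h₃ : CMAbelianVarietyRealised}
variable {L : CMField} {ι₁ : L →+* ℂ}

/-! ## One Sylvester matrix of `V` at `ι₁` frames every level of the tower -/

/-- **The Sylvester frame of the ball datum of `U.pms L ι₁ V Γ` with a prescribed matrix**: a Sylvester matrix `T` of
`V` at `ι₁` (`Tᴴ (V.Hm^{ι₁}) T = J`, e.g. from `HermSpace3.signature_ι₁`) is a Sylvester frame of the ball datum of every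
(anisotropic) level, since that datum's complex Gram matrix is `V.Hm^{ι₁}` (`Model.ballDatum_Hℂ`).
[cite: BergeronMillsonMoeglin2016Balls, Part 2 §1.1] -/
def frameOf (h₁ : BallQuotientUniformised) (h₃ : CMAbelianVarietyRealised) (V : HermSpace3 L ι₁) (T : GL (Fin 3) ℂ)
    (hT : (T : Matrix (Fin 3) (Fin 3) ℂ)ᴴ * V.Hm.map ι₁ * (T : Matrix (Fin 3) (Fin 3) ℂ) = BallModel.J)
    (Γ : Level V) (h : (pmsCode L ι₁ V Γ).IsAnisotropic) :
    (Var.ballDatum (ballQuotientUniformisedDatum_of h₁) h₃ (pmsCode L ι₁ V Γ) h).SylvesterFrame :=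
  ⟨T, by rw [ballDatum_Hℂ (ballQuotientUniformisedDatum_of h₁) h₃ Γ h]; exact hT⟩

/-- The frames `frameOf … Γ h` all have the matrix `T` (so any two levels are framed by the same matrix, the
hypothesis `𝔣'.t = 𝔣.t` of the class-lift transport lemmas). [folklore] -/
@[simp] theorem frameOf_t {V : HermSpace3 L ι₁} {T : GL (Fin 3) ℂ}
    {hT : (T : Matrix (Fin 3) (Fin 3) ℂ)ᴴ * V.Hm.map ι₁ * (T : Matrix (Fin 3) (Fin 3) ℂ) = BallModel.J}
    (Γ : Level V) (h : (pmsCode L ι₁ V Γ).IsAnisotropic) : (frameOf h₁ h₃ V T hT Γ h).t = (T : Matrix (Fin 3) (Fin 3) ℂ) :=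
  rfl

/-- A Sylvester matrix of `V` at `ι₁` exists (`HermSpace3.signature_ι₁`, `signatureMatrix 2 = J`). [folklore] -/
theorem exists_sylvesterMatrix (V : HermSpace3 L ι₁) :
    ∃ T : GL (Fin 3) ℂ, (T : Matrix (Fin 3) (Fin 3) ℂ)ᴴ * V.Hm.map ι₁ * (T : Matrix (Fin 3) (Fin 3) ℂ) = BallModel.J := by
  obtain ⟨T, hT⟩ := V.signature_ι₁
  exact ⟨T, by rw [← UnitaryBallUniformisationDatum.signatureMatrix_two]; exact hT⟩

/-! ## The existence shape of the dictionary, level-specific -/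

/-- **`LiftTranslate Θ T hT`** — the EXISTENCE shape of «Hecke translates of theta one-forms are theta one-forms» for a
family of class sets `Θ Γ ⊆ H¹(U.pms L ι₁ V Γ; ℂ)` on the tower of `V`, read in the frames of matrix `T`: for every
rational isometry `γ ∈ U(V₃,h)(L)`, every level `Γ'` at least as fine as the Hecke level `Γ.heckePair γ`, and every
`η ∈ Θ Γ`, SOME `η' ∈ Θ Γ'` has holomorphic lift `γ̂^*(lift η) : z ↦ (Jac γ̂ z)ᵀ (lift η)(γ̂ z)`, where
`γ̂ = frameIso 𝔣 γ^{ι₁} ∈ U(2,1)` is `γ` read on the ball.  This is the `transl` clause of the stage-1 ball facts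
(`HodgeCM/Automorphic/ThetaWedgeSplit.lean` `BallFacts.transl`) with the target level pinned (PerL v5 §3.1,
ll. 652–656: `γ^* u_f = u_{R(γ_f⁻¹) f}`, a form of level `γ_f⁻¹ K γ_f ⊇ K'`). [folklore] -/
@[folklore]
def LiftTranslate (hHD : exists_isReal_hodgeModel) (hI : hodgePQ_independent_of_hodgeModel) (h₁ : BallQuotientUniformised)
    (h₃ : CMAbelianVarietyRealised) {V : HermSpace3 L ι₁}
    (Θ : ∀ Γ : Level V, Set ((picardCMUniverse hHD hI h₁ h₃).CohC ((picardCMUniverse hHD hI h₁ h₃).pms L ι₁ V Γ) 1))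
    (T : GL (Fin 3) ℂ) (hT : (T : Matrix (Fin 3) (Fin 3) ℂ)ᴴ * V.Hm.map ι₁ * (T : Matrix (Fin 3) (Fin 3) ℂ) = BallModel.J) :
    Prop :=
  ∀ (Γ Γ' : Level V) (γ : GL (Fin 3) L) (hγ : γ ∈ unitaryGroup (cmConjRingHom L) V.Hm), Γ' ≤ Γ.heckePair γ hγ →
    ∀ (h : (pmsCode L ι₁ V Γ).IsAnisotropic) (h' : (pmsCode L ι₁ V Γ').IsAnisotropic), ∀ η ∈ Θ Γ, ∃ η' ∈ Θ Γ',
      (Var.ballDatum (ballQuotientUniformisedDatum_of h₁) h₃ (pmsCode L ι₁ V Γ') h').classLift hHD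
          (frameOf h₁ h₃ V T hT Γ' h') η' =
        fun z ↦ (Jac ((Var.ballDatum (ballQuotientUniformisedDatum_of h₁) h₃ (pmsCode L ι₁ V Γ) h).frameIso
            (frameOf h₁ h₃ V T hT Γ h)
            ⟨Matrix.GeneralLinearGroup.map ι₁ γ,
              map_ι₁_mem_realPoints_ballDatum (ballQuotientUniformisedDatum_of h₁) h₃ Γ h hγ⟩) z)ᵀ *ᵥ
          (Var.ballDatum (ballQuotientUniformisedDatum_of h₁) h₃ (pmsCode L ι₁ V Γ) h).classLift hHD
            (frameOf h₁ h₃ V T hT Γ h) η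
            ((Var.ballDatum (ballQuotientUniformisedDatum_of h₁) h₃ (pmsCode L ι₁ V Γ) h).frameIso
              (frameOf h₁ h₃ V T hT Γ h)
              ⟨Matrix.GeneralLinearGroup.map ι₁ γ,
                map_ι₁_mem_realPoints_ballDatum (ballQuotientUniformisedDatum_of h₁) h₃ Γ h hγ⟩ • z)

/-! ## Existence shape ⇒ `TranslateClosed` along the honest Hecke family -/

/-- **A morphism of the honest Hecke family maps `Θ Γ` into `Θ Γ'`** whenever the class sets lie in `F¹H¹` and have the
existence-shape translate property: for `g ∈ (heckeFamily …).tr Γ Γ'` with witness `γ` (`LiesOver`), the holomorphic lift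
of `g^* η` is `γ̂^*(lift η)` (`classLift_pull_mulVec` via `LiesOver.map_unif`), which by `LiftTranslate` is the lift of some
`η' ∈ Θ Γ'`; the lift is injective on `F¹H¹`, so `g^* η = η' ∈ Θ Γ'`
(`UnitaryBallClassLiftHeckePullback.pull_baseChange_mem_of_exists_classLift_eq_translate`).  Codes are anisotropic because
`2 < [L:ℚ]`. [cite: Shimura1973, §7.2–7.3] [cite: Borel1997, §5.13–5.14] -/
theorem image_pullC_subset_of_liftTranslate (hL : 2 < Module.finrank ℚ L) {V : HermSpace3 L ι₁}
    {Θ : ∀ Γ : Level V, Set ((picardCMUniverse hHD hI h₁ h₃).CohC ((picardCMUniverse hHD hI h₁ h₃).pms L ι₁ V Γ) 1)}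
    (hF : ∀ Γ : Level V, Θ Γ ⊆
      (((picardCMUniverse hHD hI h₁ h₃).hodge ((picardCMUniverse hHD hI h₁ h₃).pms L ι₁ V Γ) 1).F 1 : Set _))
    {T : GL (Fin 3) ℂ} {hT : (T : Matrix (Fin 3) (Fin 3) ℂ)ᴴ * V.Hm.map ι₁ * (T : Matrix (Fin 3) (Fin 3) ℂ) = BallModel.J}
    (hΘ : LiftTranslate hHD hI h₁ h₃ Θ T hT) {Γ Γ' : Level V}
    {g : (picardCMUniverse hHD hI h₁ h₃).Mor ((picardCMUniverse hHD hI h₁ h₃).pms L ι₁ V Γ')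
      ((picardCMUniverse hHD hI h₁ h₃).pms L ι₁ V Γ)}
    (hg : g ∈ (heckeFamily hHD hI h₁ h₃).tr Γ Γ') :
    (picardCMUniverse hHD hI h₁ h₃).pullC g 1 '' Θ Γ ⊆ Θ Γ' := by
  obtain ⟨γ, hγ, hgγ⟩ := hg
  have h : (pmsCode L ι₁ V Γ).IsAnisotropic := isAnisotropic_pmsCode_of_two_lt hL Γ
  have h' : (pmsCode L ι₁ V Γ').IsAnisotropic := isAnisotropic_pmsCode_of_two_lt hL Γ'
  rintro _ ⟨η, hη, rfl⟩
  exact (Var.ballDatum (ballQuotientUniformisedDatum_of h₁) h₃ (pmsCode L ι₁ V Γ) h)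
    |>.pull_baseChange_mem_of_exists_classLift_eq_translate
      (Var.ballDatum (ballQuotientUniformisedDatum_of h₁) h₃ (pmsCode L ι₁ V Γ') h') (frameOf h₁ h₃ V T hT Γ h)
      (frameOf h₁ h₃ V T hT Γ' h') hHD hI g rfl (hgγ.map_ι₁_mem_realPoints h) (hgγ.2 h' h) (hF Γ') (hF Γ hη)
      (hΘ Γ Γ' γ hγ hgγ.1 h h' η hη)

/-- **`TranslateClosed` along the honest Hecke family from the existence shape.**  For a theta supply datum `S` on
`U.pms L ι₁ V ·` (`2 < [L:ℚ]`) whose four theta-class families have `LiftTranslate` in some Sylvester matrix `T`: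
`S.TranslateClosed (heckeFamily hHD hI h₁ h₃)`.  (`S.Theta i Γ ⊆ U_{Ψ i}(Γ) ⊆ H^{1,0} ⊆ F¹` by `Theta_sub`,
`Universe.Uiso_le_piece10`, `Model.universeOf_fact_pull_hodge`.) [cite: Shimura1973, §7.2–7.3] [cite: Borel1997, §5.13–5.14] -/
theorem translateClosed_heckeFamily_of_liftTranslate (hL : 2 < Module.finrank ℚ L) {V : HermSpace3 L ι₁}
    {K : CMField} {Ψ : Fin 4 → CMType K} {σ : K →+* ℂ}
    (S : FaceThetaSupply (picardCMUniverse hHD hI h₁ h₃) ι₁ V K Ψ σ)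
    {T : GL (Fin 3) ℂ} {hT : (T : Matrix (Fin 3) (Fin 3) ℂ)ᴴ * V.Hm.map ι₁ * (T : Matrix (Fin 3) (Fin 3) ℂ) = BallModel.J}
    (hΘ : ∀ i : Fin 4, LiftTranslate hHD hI h₁ h₃ (S.Theta i) T hT) :
    S.TranslateClosed (heckeFamily hHD hI h₁ h₃) := by
  intro i Γ Γ' g hg η hη
  have hF : ∀ Γ₀ : Level V, S.Theta i Γ₀ ⊆
      (((picardCMUniverse hHD hI h₁ h₃).hodge ((picardCMUniverse hHD hI h₁ h₃).pms L ι₁ V Γ₀) 1).F 1 : Set _) :=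
    fun Γ₀ η₀ hη₀ ↦ HodgeStructure.piece_le_F _ 1 0
      (Universe.Uiso_le_piece10 (universeOf_fact_pull_hodge hHD hI (ballQuotientUniformisedDatum_of h₁) h₃) Γ₀ K (Ψ i) σ
        (S.Theta_sub i Γ₀ hη₀))
  exact image_pullC_subset_of_liftTranslate hL hF (hΘ i) hg ⟨η, hη, rfl⟩

/-- **PerL Prop 4.3 on the model universe from the existence-shape translate property** — for ANY theta supply datum
`S` on the tower of `V` (`2 < [L:ℚ]`) whose theta sets have `LiftTranslate` in some Sylvester matrix: `S.Wedge`
(B01-H within the honest Hecke family, `heckeWedge10Within_holds`, + `TranslateClosed`).  Degree- and face-free;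
HC_CM is NOT proved. [folklore] -/
theorem wedge_of_liftTranslate (hL : 2 < Module.finrank ℚ L) {V : HermSpace3 L ι₁}
    {K : CMField} {Ψ : Fin 4 → CMType K} {σ : K →+* ℂ}
    (S : FaceThetaSupply (picardCMUniverse hHD hI h₁ h₃) ι₁ V K Ψ σ)
    {T : GL (Fin 3) ℂ} {hT : (T : Matrix (Fin 3) (Fin 3) ℂ)ᴴ * V.Hm.map ι₁ * (T : Matrix (Fin 3) (Fin 3) ℂ) = BallModel.J}
    (hΘ : ∀ i : Fin 4, LiftTranslate hHD hI h₁ h₃ (S.Theta i) T hT) : S.Wedge :=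
  wedge_of_translateClosed_heckeFamily S (translateClosed_heckeFamily_of_liftTranslate hL S hΘ)

/-- The same at a FACE of a Galois CM field of degree `≥ 6` (`2 < 6 ≤ [F:ℚ]`), the setting of `FaceThetaDataExists`.
[folklore] -/
theorem wedge_of_liftTranslate_face {F : CMField} (h6 : 6 ≤ Module.finrank ℚ F) {ι₁ : F →+* ℂ} {V : HermSpace3 F ι₁}
    {f : Face F} {σ : F →+* ℂ} (S : FaceThetaSupply (picardCMUniverse hHD hI h₁ h₃) ι₁ V F f.psi σ)
    {T : GL (Fin 3) ℂ} {hT : (T : Matrix (Fin 3) (Fin 3) ℂ)ᴴ * V.Hm.map ι₁ * (T : Matrix (Fin 3) (Fin 3) ℂ) = BallModel.J}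
    (hΘ : ∀ i : Fin 4, LiftTranslate hHD hI h₁ h₃ (S.Theta i) T hT) : S.Wedge :=
  wedge_of_liftTranslate (by omega) S hΘ

#print axioms wedge_of_liftTranslate

end Summit.HodgeConjecture.CorCM.Transposition.Model

end
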